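import Summits.Ventures.YMGap.RobustBall.RowsSUN
import Summits.Ventures.YMGap.RobustBall.RowsS
import Summits.Ventures.YMGap.RobustBall.MassGapOnBallMassive
import Summits.Ventures.YMGap.RobustBall.TorusDoorSUN
import HarnessLib

/-!
# Venture YMGap, track Y2 ROBUST-BALL — ALL-`N` `ℤ^d` CELLS with `N`-UNIFORM one-parameter radii (hypothesis-free):
# tier 1 (`MassGapOnBallZd`), its massive-state twin (`d = 4`), and tier 2 (`MassGapOnBallZdS`), every `N ≥ 2`

HONEST FRAMING.  Venture file of the cell `pub-ymgap` (QuantumFields programme), track ROBUST-BALL, seat p1 (g7).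
Strong-coupling LATTICE statements only: `SU(N)` lattice Yang–Mills on `ℤ^d` at 't Hooft coupling `β` (the `ℤ^d` predicates
take 't Hooft `β`; tree coupling `N β`; `SU(2)` Wilson `β_W = 4β`) plus a link perturbation in the cell's typed `ℤ^d` balls
(`MemBallZd ε₀ ε₁ R`, `MemBallZdS a Λ t`).  DLR uniqueness + exponential clustering / Osterwalder–Seiler massive states as
typed by the tree currencies — never a transfer-matrix spectral gap, nothing about the continuum or the Clay problem.  Kernel
ARITHMETIC over tree theorems (p2's `suN_massGapOnBallZd_bakryEmery`, rb-p1's `suN_massGapOnBallZdS_bakryEmery`, ds-3's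
`massive_onBallZd_of_massGapOnBallZd`, this seat's `rowValue_le_taylor`); no certificate file, no named hypothesis.

PURPOSE.  p2's `RowsSUN` gives the every-`N` `ℤ⁴` row at `(β, ε₀, ε₁) = (1/64, 1/10, 1/10)` — radii not in the cell's
one-parameter convention `(2ε, ε)`.  The `ℤ^d` door has the SAME row value as the torus door of `TorusDoorSUN`
(`e^{ε₀}·6(d−1)t/(1/2 − 2(d−1)t) + e^{ε₀/2}·ε₁/√(N(1/2 − 2(d−1)t))`, decreasing in `N`), so the torus certificates of
`TorusRowsSUN` serve verbatim: this file records the every-`N`, `N`-UNIFORM, one-parameter-maximal `ℤ^d` cells, valid at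
every 't Hooft coupling `|β| ≤ t` below the ceiling (the torus rows' `UpTo` form), with their massive and tier-2 twins.

CONTENT.  Schemas `suN_massGapOnBallZd_of_cert` (tier 1, every `d ≥ 1`), `suN_massGapOnBallZdS_of_cert` (tier 2, weight
`e^{t} = w > 1`); CELLS, every `N ≥ 2`, every range `R`: `d = 4`: `(1/64, .110)`, `(1/96, .233)` + massive twins, tier 2
`(1/96, log 6/5, .190)`; `d = 3`: `(1/48, .149)`, `(1/64, .233)`, tier 2 `(1/64, log 6/5, .190)`.
NOT CLAIMED: optimality; anything sharper than the certified `SU(2)`/`SU(3)` files for `N = 2, 3` (`RowsSU2*`, `RowsSU3*`,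
`RowsDim3`, `RowsS`); in `SU(2)` Wilson units these cells sit at `β_W ≤ 1/12`.
-/

noncomputable section

open MeasureTheory ProbabilityTheory Real
open Literature.Probability.LatticeModels
open Literature.MathematicalPhysics.QuantumLattice
open Literature.MathematicalPhysics.QuantumFieldTheory hiding ZdEdge
open Literature.Barriers.QuantumFields (IsMassiveState)
open Summit.Ventures.YMGap.RobustBall

namespace Summit.Ventures.YMGap.RobustBallSUN

variable {d N : ℕ}

/-! ### 1. Schemas: the sharp-`N` doors bounded by the `N = 2` Taylor certificate -/

/-- Monotonicity bookkeeping shared by the two schemas: for `|β| ≤ t`, `b⋆ = 2(d−1)t < 1/2`, `N ≥ 2`, `E, F, ε₁ ≥ 0`,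
`6(d−1)|β|·E/(1/2 − 2(d−1)|β|) + F·ε₁/√(N(1/2 − 2(d−1)|β|)) ≤ E·(6(d−1)t)/(1/2 − b⋆) + F·ε₁/√(2(1/2 − b⋆))`. [folklore] -/
theorem zd_rowValue_mono (hd : 1 ≤ d) (hN : 2 ≤ N) {β t E F ε₁ : ℝ} (hE : 0 ≤ E) (hF : 0 ≤ F) (hε₁ : 0 ≤ ε₁)
    (hβt : |β| ≤ t) (ht : t * (2 * ((d : ℝ) - 1)) < 1 / 2) :
    6 * ((d : ℝ) - 1) * |β| * E / (1 / 2 - |β| * (2 * ((d : ℝ) - 1))) +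
        F * ε₁ / Real.sqrt ((N : ℝ) * (1 / 2 - |β| * (2 * ((d : ℝ) - 1)))) ≤
      E * (t * (6 * ((d : ℝ) - 1))) / (1 / 2 - t * (2 * ((d : ℝ) - 1))) +
        F * ε₁ / Real.sqrt (2 * (1 / 2 - t * (2 * ((d : ℝ) - 1)))) := by
  have hN2 : (2 : ℝ) ≤ N := by exact_mod_cast hN
  have hd1 : (0 : ℝ) ≤ (d : ℝ) - 1 := by
    have : (1 : ℝ) ≤ d := by exact_mod_cast hd
    linarith
  have hbb : |β| * (2 * ((d : ℝ) - 1)) ≤ t * (2 * ((d : ℝ) - 1)) :=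
    mul_le_mul_of_nonneg_right hβt (by positivity)
  have hgap : 0 < 1 / 2 - t * (2 * ((d : ℝ) - 1)) := by linarith
  have hgapβ : 1 / 2 - t * (2 * ((d : ℝ) - 1)) ≤ 1 / 2 - |β| * (2 * ((d : ℝ) - 1)) := by linarith
  have ht0 : 0 ≤ t := le_trans (abs_nonneg _) hβt
  refine add_le_add ?_ ?_
  · rw [div_eq_mul_one_div, div_eq_mul_one_div (E * _)]
    refine mul_le_mul ?_ (one_div_le_one_div_of_le hgap hgapβ) (one_div_nonneg.2 (hgap.le.trans hgapβ))
      (mul_nonneg hE (by positivity))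
    calc 6 * ((d : ℝ) - 1) * |β| * E = E * (|β| * (6 * ((d : ℝ) - 1))) := by ring
      _ ≤ E * (t * (6 * ((d : ℝ) - 1))) :=
          mul_le_mul_of_nonneg_left (mul_le_mul_of_nonneg_right hβt (by positivity)) hE
  · rw [div_eq_mul_one_div, div_eq_mul_one_div (F * ε₁)]
    refine mul_le_mul_of_nonneg_left ?_ (by positivity)
    exact one_div_le_one_div_of_le (Real.sqrt_pos.2 (by positivity))
      (Real.sqrt_le_sqrt (mul_le_mul hN2 hgapβ hgap.le (Nat.cast_nonneg _)))

/-- **ROW SCHEMA, tier 1 on `ℤ^d`, every `N ≥ 2`, every `d ≥ 1`**: for 't Hooft `|β| ≤ t` with `b⋆ = 2(d−1)t < 1/2`, radii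
`0 ≤ ε₀ ≤ 1`, `0 ≤ ε₁`, a rational `s ≥ 0` with `1 ≤ 2(1/2 − b⋆)s²` and the rational certificate
`T₆(ε₀)·6(d−1)t/(1/2 − b⋆) + T₆(ε₀/2)·ε₁·s < 1`: `MassGapOnBallZd d N β ε₀ ε₁ R` for every range `R` (p2's Bakry–Émery pair door).
[folklore] -/
theorem suN_massGapOnBallZd_of_cert (hd : 1 ≤ d) (hN : 2 ≤ N) {β t ε₀ ε₁ s : ℝ} (hβt : |β| ≤ t)
    (ht : t * (2 * ((d : ℝ) - 1)) < 1 / 2) (h0 : 0 ≤ ε₀) (h1 : ε₀ ≤ 1) (hε₁ : 0 ≤ ε₁) (hs : 0 ≤ s)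
    (hqs : 1 ≤ 2 * (1 / 2 - t * (2 * ((d : ℝ) - 1))) * s ^ 2)
    (hcert : (1 + ε₀ + ε₀ ^ 2 / 2 + ε₀ ^ 3 / 6 + ε₀ ^ 4 / 24 + ε₀ ^ 5 / 120 + 7 / 4320 * ε₀ ^ 6) *
        (t * (6 * ((d : ℝ) - 1)) / (1 / 2 - t * (2 * ((d : ℝ) - 1)))) +
      (1 + ε₀ / 2 + (ε₀ / 2) ^ 2 / 2 + (ε₀ / 2) ^ 3 / 6 + (ε₀ / 2) ^ 4 / 24 + (ε₀ / 2) ^ 5 / 120 +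
        7 / 4320 * (ε₀ / 2) ^ 6) * ε₁ * s < 1) (R : ℝ) :
    MassGapOnBallZd d N β ε₀ ε₁ R := by
  have hd1 : (0 : ℝ) ≤ (d : ℝ) - 1 := by
    have : (1 : ℝ) ≤ d := by exact_mod_cast hd
    linarith
  have ht0 : 0 ≤ t := le_trans (abs_nonneg _) hβt
  have hgap : 0 < 1 / 2 - t * (2 * ((d : ℝ) - 1)) := by linarith
  have hb : |β| * (2 * ((d : ℝ) - 1)) < 1 / 2 :=
    lt_of_le_of_lt (mul_le_mul_of_nonneg_right hβt (by positivity)) ht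
  have hA : 0 ≤ t * (6 * ((d : ℝ) - 1)) / (1 / 2 - t * (2 * ((d : ℝ) - 1))) := by positivity
  refine suN_massGapOnBallZd_bakryEmery hd hN R hb (lt_of_le_of_lt ?_ hcert)
  refine (zd_rowValue_mono hd hN (Real.exp_pos _).le (Real.exp_pos _).le hε₁ hβt ht).trans ?_
  rw [mul_div_assoc]
  exact rowValue_le_taylor hA hε₁ (by positivity) h0 h1 hs hqs

/-- **ROW SCHEMA, tier 2 on `ℤ^d` (summable support-free ball `MemBallZdS ε₀ ε₁ (log w)`, weight `w > 1`), every `N ≥ 2`,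
every `d ≥ 1`**: the rational certificate `w·T₆(ε₀)·6(d−1)t/(1/2 − b⋆) + T₆(ε₀/2)·ε₁·s < 1` gives
`MassGapOnBallZdS d N β ε₀ ε₁ (log w)` at every 't Hooft `|β| ≤ t` (rb-p1's weighted pair door, rate `log w`). [folklore] -/
theorem suN_massGapOnBallZdS_of_cert (hd : 1 ≤ d) (hN : 2 ≤ N) {β w t ε₀ ε₁ s : ℝ} (hw : 1 < w) (hβt : |β| ≤ t)
    (ht : t * (2 * ((d : ℝ) - 1)) < 1 / 2) (h0 : 0 ≤ ε₀) (h1 : ε₀ ≤ 1) (hε₁ : 0 ≤ ε₁) (hs : 0 ≤ s)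
    (hqs : 1 ≤ 2 * (1 / 2 - t * (2 * ((d : ℝ) - 1))) * s ^ 2)
    (hcert : w * (1 + ε₀ + ε₀ ^ 2 / 2 + ε₀ ^ 3 / 6 + ε₀ ^ 4 / 24 + ε₀ ^ 5 / 120 + 7 / 4320 * ε₀ ^ 6) *
        (t * (6 * ((d : ℝ) - 1)) / (1 / 2 - t * (2 * ((d : ℝ) - 1)))) +
      (1 + ε₀ / 2 + (ε₀ / 2) ^ 2 / 2 + (ε₀ / 2) ^ 3 / 6 + (ε₀ / 2) ^ 4 / 24 + (ε₀ / 2) ^ 5 / 120 +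
        7 / 4320 * (ε₀ / 2) ^ 6) * ε₁ * s < 1) :
    MassGapOnBallZdS d N β ε₀ ε₁ (Real.log w) := by
  have hd1 : (0 : ℝ) ≤ (d : ℝ) - 1 := by
    have : (1 : ℝ) ≤ d := by exact_mod_cast hd
    linarith
  have ht0 : 0 ≤ t := le_trans (abs_nonneg _) hβt
  have hgap : 0 < 1 / 2 - t * (2 * ((d : ℝ) - 1)) := by linarith
  have hw0 : 0 < w := by linarith
  have hb : |β| * (2 * ((d : ℝ) - 1)) < 1 / 2 :=
    lt_of_le_of_lt (mul_le_mul_of_nonneg_right hβt (by positivity)) ht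
  have hA : 0 ≤ t * (6 * ((d : ℝ) - 1)) / (1 / 2 - t * (2 * ((d : ℝ) - 1))) := by positivity
  refine suN_massGapOnBallZdS_bakryEmery hd hN (Real.log_pos hw) hb (lt_of_le_of_lt ?_ hcert)
  rw [Real.exp_log hw0]
  refine (zd_rowValue_mono hd hN (by positivity) (Real.exp_pos _).le hε₁ hβt ht).trans ?_
  have h := rowValue_le_taylor (mul_nonneg hw0.le hA) hε₁ (by positivity : (0 : ℝ) < 2 * (1 / 2 - t * (2 * ((d : ℝ) - 1))))
    h0 h1 hs hqs (ε₁ := ε₁)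
  calc Real.exp ε₀ * w * (t * (6 * ((d : ℝ) - 1))) / (1 / 2 - t * (2 * ((d : ℝ) - 1))) +
        Real.exp (ε₀ / 2) * ε₁ / Real.sqrt (2 * (1 / 2 - t * (2 * ((d : ℝ) - 1))))
      = Real.exp ε₀ * (w * (t * (6 * ((d : ℝ) - 1)) / (1 / 2 - t * (2 * ((d : ℝ) - 1))))) +
        Real.exp (ε₀ / 2) * ε₁ / Real.sqrt (2 * (1 / 2 - t * (2 * ((d : ℝ) - 1)))) := by ring
    _ ≤ _ := h
    _ = _ := by ring

/-! ### 2. Cells, every `N ≥ 2`, every range (one `norm_num` certificate each; the torus rows' certificates verbatim) -/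

/-- **`ℤ⁴` CELL, every `N ≥ 2`: `(t, ε₀, ε₁) = (1/64, 11/50, 11/100)`** (one-parameter `ε = 0.110`; `SU(2)` Wilson `β_W = 1/16`):
every 't Hooft `|β| ≤ 1/64`, every `R`: `MassGapOnBallZd 4 N β (11/50) (11/100) R`.  Hypothesis-free. [folklore] -/
theorem suN_zdRow4_1_64 (hN : 2 ≤ N) {β : ℝ} (hβ : |β| ≤ 1 / 64) (R : ℝ) : MassGapOnBallZd 4 N β (11 / 50) (11 / 100) R :=
  suN_massGapOnBallZd_of_cert (d := 4) (by norm_num) hN (s := 2773501 / 2500000) hβ (by norm_num) (by norm_num)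
    (by norm_num) (by norm_num) (by norm_num) (by norm_num) (by norm_num) R

/-- **`ℤ⁴` CELL, every `N ≥ 2`: `(t, ε₀, ε₁) = (1/96, 233/500, 233/1000)`** (`ε = 0.233`; `SU(2)` Wilson `β_W = 1/24`):
`|β| ≤ 1/96 ⇒ MassGapOnBallZd 4 N β (233/500) (233/1000) R`.  Hypothesis-free. [folklore] -/
theorem suN_zdRow4_1_96 (hN : 2 ≤ N) {β : ℝ} (hβ : |β| ≤ 1 / 96) (R : ℝ) :
    MassGapOnBallZd 4 N β (233 / 500) (233 / 1000) R :=
  suN_massGapOnBallZd_of_cert (d := 4) (by norm_num) hN (s := 213809 / 200000) hβ (by norm_num) (by norm_num)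
    (by norm_num) (by norm_num) (by norm_num) (by norm_num) (by norm_num) R

/-- **`ℤ³` CELL, every `N ≥ 2`: `(t, ε₀, ε₁) = (1/48, 149/500, 149/1000)`** (`ε = 0.149`; `SU(2)` Wilson `β_W = 1/12`):
`|β| ≤ 1/48 ⇒ MassGapOnBallZd 3 N β (149/500) (149/1000) R`.  Hypothesis-free. [folklore] -/
theorem suN_zdRow3_1_48 (hN : 2 ≤ N) {β : ℝ} (hβ : |β| ≤ 1 / 48) (R : ℝ) :
    MassGapOnBallZd 3 N β (149 / 500) (149 / 1000) R :=
  suN_massGapOnBallZd_of_cert (d := 3) (by norm_num) hN (s := 2738613 / 2500000) hβ (by norm_num) (by norm_num)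
    (by norm_num) (by norm_num) (by norm_num) (by norm_num) (by norm_num) R

/-- **`ℤ³` CELL, every `N ≥ 2`: `(t, ε₀, ε₁) = (1/64, 233/500, 233/1000)`** (`ε = 0.233`; `SU(2)` Wilson `β_W = 1/16`):
`|β| ≤ 1/64 ⇒ MassGapOnBallZd 3 N β (233/500) (233/1000) R`.  Hypothesis-free. [folklore] -/
theorem suN_zdRow3_1_64 (hN : 2 ≤ N) {β : ℝ} (hβ : |β| ≤ 1 / 64) (R : ℝ) :
    MassGapOnBallZd 3 N β (233 / 500) (233 / 1000) R :=
  suN_massGapOnBallZd_of_cert (d := 3) (by norm_num) hN (s := 213809 / 200000) hβ (by norm_num) (by norm_num)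
    (by norm_num) (by norm_num) (by norm_num) (by norm_num) (by norm_num) R

/-- **`ℤ⁴` TIER-2 CELL, every `N ≥ 2`: `(t, rate, ε₀, ε₁) = (1/96, log 6/5, 19/50, 19/100)`** (`ε = 0.190`):
`|β| ≤ 1/96 ⇒ MassGapOnBallZdS 4 N β (19/50) (19/100) (log 6/5)` — the summable support-free ball with `e^{t‖·‖}`-weighted
cross load, clustering rate `log 6/5`.  Hypothesis-free. [folklore] -/
theorem suN_zdRowS4_1_96 (hN : 2 ≤ N) {β : ℝ} (hβ : |β| ≤ 1 / 96) :
    MassGapOnBallZdS 4 N β (19 / 50) (19 / 100) (Real.log (6 / 5)) :=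
  suN_massGapOnBallZdS_of_cert (d := 4) (by norm_num) hN (w := 6 / 5) (s := 213809 / 200000) (by norm_num) hβ
    (by norm_num) (by norm_num) (by norm_num) (by norm_num) (by norm_num) (by norm_num) (by norm_num)

/-- **`ℤ³` TIER-2 CELL, every `N ≥ 2`: `(t, rate, ε₀, ε₁) = (1/64, log 6/5, 19/50, 19/100)`** (`ε = 0.190`):
`|β| ≤ 1/64 ⇒ MassGapOnBallZdS 3 N β (19/50) (19/100) (log 6/5)`.  Hypothesis-free. [folklore] -/
theorem suN_zdRowS3_1_64 (hN : 2 ≤ N) {β : ℝ} (hβ : |β| ≤ 1 / 64) :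
    MassGapOnBallZdS 3 N β (19 / 50) (19 / 100) (Real.log (6 / 5)) :=
  suN_massGapOnBallZdS_of_cert (d := 3) (by norm_num) hN (w := 6 / 5) (s := 213809 / 200000) (by norm_num) hβ
    (by norm_num) (by norm_num) (by norm_num) (by norm_num) (by norm_num) (by norm_num) (by norm_num)

/-! ### 3. Massive-state twins of the `ℤ⁴` cells (ds-3's tier-1 conversion, every `N ≥ 2`) -/

/-- **MASSIVE TWIN of the `ℤ⁴` cell `(1/64, .110)`**, every `N ≥ 2`, every 't Hooft `|β| ≤ 1/64`, every range `R`, every member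
`W ∈ MemBallZd (11/50) (11/100) R`: the perturbed DLR set at tree coupling `N β` is non-empty and EVERY DLR state is an
Osterwalder–Seiler massive state with exponentially decaying plaquette–plaquette correlations. [folklore] -/
theorem suN_zdMassiveRow4_1_64 (hN : 2 ≤ N) {β : ℝ} (hβ : |β| ≤ 1 / 64) (R : ℝ)
    {W : Potential (ZdEdge 4) (Matrix.specialUnitaryGroup (Fin N) ℂ)} {supp : Finset (ZdEdge 4) → Finset (Finset (ZdEdge 4))}
    (hmem : MemBallZd (11 / 50) (11 / 100) R W supp) :
    (perturbedGibbsMeasures (d := 4) (fundamentalRep (Fin N)) ((N : ℝ) * β) W supp).Nonempty ∧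
      ∀ μ ∈ perturbedGibbsMeasures (d := 4) (fundamentalRep (Fin N)) ((N : ℝ) * β) W supp,
        IsMassiveState μ ∧ HasExponentialDecay (plaquetteCorrFn (fundamentalRep (Fin N)) μ) :=
  massive_onBallZd_of_massGapOnBallZd (by omega) (suN_zdRow4_1_64 hN hβ R) hmem

/-- **MASSIVE TWIN of the `ℤ⁴` cell `(1/96, .233)`**, every `N ≥ 2`, every `|β| ≤ 1/96`, every `R`, every member of
`MemBallZd (233/500) (233/1000) R`. [folklore] -/
theorem suN_zdMassiveRow4_1_96 (hN : 2 ≤ N) {β : ℝ} (hβ : |β| ≤ 1 / 96) (R : ℝ)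
    {W : Potential (ZdEdge 4) (Matrix.specialUnitaryGroup (Fin N) ℂ)} {supp : Finset (ZdEdge 4) → Finset (Finset (ZdEdge 4))}
    (hmem : MemBallZd (233 / 500) (233 / 1000) R W supp) :
    (perturbedGibbsMeasures (d := 4) (fundamentalRep (Fin N)) ((N : ℝ) * β) W supp).Nonempty ∧
      ∀ μ ∈ perturbedGibbsMeasures (d := 4) (fundamentalRep (Fin N)) ((N : ℝ) * β) W supp,
        IsMassiveState μ ∧ HasExponentialDecay (plaquetteCorrFn (fundamentalRep (Fin N)) μ) :=
  massive_onBallZd_of_massGapOnBallZd (by omega) (suN_zdRow4_1_96 hN hβ R) hmem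

end Summit.Ventures.YMGap.RobustBallSUN

end
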